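import Mathlib
import HarnessLib

/-!
# The entropy–Brégman log-sum estimate

The elementary real-analysis estimate behind the entropy proof of Brégman's theorem
[Radhakrishnan1997] and its stability version (Cuckler–Kahn, "minus one nat per vertex"
[CucklerKahn2009]): for `n ≥ 2` and `0 < w < 1`,

  `∑_{k<n} log (w + (1-w)·k/(n-1)) ≤ (n-1)·(-1 + w·log(1/w)/(1-w)) ≤ (n-1)·(2√w - 1)`

(`sum_log_affine_le_sharp`, `sum_log_affine_le_two_sqrt`, and the weaker `4√w` form
`sum_log_affine_le` consumed downstream).  The left-hand side is `n` times the expected logarithm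
of the mass `w + (1-w)·u` still available at a uniformly random position `u = k/(n-1)`; it is a
left Riemann sum of the concave function `u ↦ log (w + (1-w)u)`, hence at most
`(n-1)·∫₀¹ log (w + (1-w)u) du = (n-1)·(-1 + w·log(1/w)/(1-w))`.

The proof is integral-free: with `F v = v log v - v` the tangent-line inequality
`(b - a)·log a ≤ F b - F a` (`sub_mul_log_le`, from `log x ≤ x - 1`) telescopes along the
arithmetic progression `v_k = w + (1-w)·k/(n-1)` (`mul_sum_log_affine_le`), and
`w·log(1/w) ≤ 2√w·(1-w)` (`mul_log_one_div_le`, again from `log x ≤ x - 1` at `x = 1/√w`)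
gives the square-root form.  Nothing here is specific to permutations; no integrals, entropies
or permanents are introduced.

References: J. Radhakrishnan, An entropy proof of Bregman's theorem, *J. Combin. Theory Ser. A*
77 (1997) 161–164 [Radhakrishnan1997]; B. Cuckler, J. Kahn, Entropy bounds for perfect matchings
and Hamiltonian cycles, *Combinatorica* 29 (2009) 327–335 [CucklerKahn2009].
-/

namespace Literature.Combinatorics.Enumerative

open Finset

/-! ### Two one-variable inequalities from `log x ≤ x - 1` -/

/-- Tangent-line (convexity) inequality for `F v = v·log v - v`, whose derivative is `log v`:
for `a, b > 0`, `(b - a)·log a ≤ F b - F a`.  Equivalent to `b·log (a/b) ≤ a - b`, i.e. to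
`log x ≤ x - 1` at `x = a/b`. [folklore] -/
theorem sub_mul_log_le {a b : ℝ} (ha : 0 < a) (hb : 0 < b) :
    (b - a) * Real.log a ≤ (b * Real.log b - b) - (a * Real.log a - a) := by
  have h := Real.log_le_sub_one_of_pos (div_pos ha hb)
  rw [Real.log_div ha.ne' hb.ne'] at h
  have h2 : b * (Real.log a - Real.log b) ≤ b * (a / b - 1) :=
    mul_le_mul_of_nonneg_left h hb.le
  have h3 : b * (a / b - 1) = a - b := by
    field_simp
  nlinarith [h2, h3]

/-- `w·log (1/w) ≤ 2·√w·(1 - w)` for `0 < w ≤ 1`: with `s = √w`,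
`w·log(1/w) = 2 s²·log(1/s) ≤ 2 s² (1/s - 1) = 2 s (1 - s) ≤ 2 s (1 - s²)`. [folklore] -/
theorem mul_log_one_div_le {w : ℝ} (hw : 0 < w) (hw1 : w ≤ 1) :
    w * Real.log (1 / w) ≤ 2 * Real.sqrt w * (1 - w) := by
  obtain ⟨s, hs, rfl⟩ : ∃ s, 0 < s ∧ w = s * s :=
    ⟨Real.sqrt w, Real.sqrt_pos.mpr hw, (Real.mul_self_sqrt hw.le).symm⟩
  rw [Real.sqrt_mul_self hs.le]
  have hs1 : s ≤ 1 := by nlinarith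
  have hlog : Real.log (1 / (s * s)) = 2 * Real.log (1 / s) := by
    rw [one_div, one_div, Real.log_inv, Real.log_inv, Real.log_mul hs.ne' hs.ne']
    ring
  have h1 : Real.log (1 / s) ≤ 1 / s - 1 := Real.log_le_sub_one_of_pos (by positivity)
  have hss : s * s ≤ s := mul_le_of_le_one_right hs.le hs1
  rw [hlog]
  calc s * s * (2 * Real.log (1 / s)) = 2 * (s * s * Real.log (1 / s)) := by ring
    _ ≤ 2 * (s * s * (1 / s - 1)) := by gcongr
    _ = 2 * s * (1 - s) := by
      field_simp
    _ ≤ 2 * s * (1 - s * s) := by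
      apply mul_le_mul_of_nonneg_left _ (by positivity)
      linarith

/-! ### Telescoping along the arithmetic progression `w + (1-w)·k/N` -/

/-- Telescoped tangent-line bound: for `0 < w < 1`, `N > 0` and every `m`,
`((1-w)/N)·∑_{k<m} log v_k ≤ F v_m - F v_0` where `v_k = w + (1-w)·k/N` (so `v_{k+1} - v_k =
(1-w)/N`, `v_0 = w`) and `F v = v·log v - v`; induction on `m` using `sub_mul_log_le`. [folklore] -/
theorem mul_sum_log_affine_le {w N : ℝ} (hw : 0 < w) (hw1 : w < 1) (hN : 0 < N) (m : ℕ) :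
    (1 - w) / N * ∑ k ∈ Finset.range m, Real.log (w + (1 - w) * ((k : ℝ) / N)) ≤
      ((w + (1 - w) * ((m : ℝ) / N)) * Real.log (w + (1 - w) * ((m : ℝ) / N)) -
          (w + (1 - w) * ((m : ℝ) / N))) -
        (w * Real.log w - w) := by
  have hpos : ∀ x : ℝ, 0 ≤ x → 0 < w + (1 - w) * (x / N) := fun x hx => by
    have : 0 ≤ (1 - w) * (x / N) := mul_nonneg (by linarith) (div_nonneg hx hN.le)
    linarith
  induction m with
  | zero => simp
  | succ m ih =>
    rw [Finset.sum_range_succ, mul_add]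
    have hcell := sub_mul_log_le (hpos m (Nat.cast_nonneg m))
      (hpos ((m + 1 : ℕ) : ℝ) (Nat.cast_nonneg _))
    have hdiff : (w + (1 - w) * (((m + 1 : ℕ) : ℝ) / N)) - (w + (1 - w) * ((m : ℝ) / N)) =
        (1 - w) / N := by
      push_cast
      field_simp
      ring
    rw [hdiff] at hcell
    linarith [ih, hcell]

/-! ### The log-sum estimate -/

/-- **Entropy–Brégman log-sum estimate, sharp form.**  For `n ≥ 2` and `0 < w < 1`,
`∑_{k<n} log (w + (1-w)·k/(n-1)) ≤ (n-1)·(-1 + w·log(1/w)/(1-w))`; the right-hand side is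
`(n-1)·∫₀¹ log (w + (1-w)u) du`.  The `k = n-1` term vanishes and the remaining left Riemann sum
is bounded by telescoping `mul_sum_log_affine_le` (`F 1 - F w = -1 - w log w + w`).  This is the
averaging step of the entropy proof of Brégman's theorem. [cite: Radhakrishnan1997, proof of Thm 1] -/
theorem sum_log_affine_le_sharp (n : ℕ) (hn : 2 ≤ n) (w : ℝ) (hw : 0 < w) (hw1 : w < 1) :
    ∑ k ∈ Finset.range n, Real.log (w + (1 - w) * ((k : ℝ) / ((n : ℝ) - 1))) ≤
      ((n : ℝ) - 1) * (-1 + w * Real.log (1 / w) / (1 - w)) := by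
  obtain ⟨N, rfl⟩ : ∃ N, n = N + 1 := ⟨n - 1, by omega⟩
  have hN : (0 : ℝ) < N := by exact_mod_cast (by omega : 0 < N)
  have h1w : (0 : ℝ) < 1 - w := by linarith
  have hcast : ((N + 1 : ℕ) : ℝ) - 1 = N := by
    push_cast
    ring
  have hvN : w + (1 - w) * ((N : ℝ) / N) = 1 := by
    rw [div_self hN.ne']
    ring
  rw [hcast, Finset.sum_range_succ, hvN, Real.log_one, add_zero]
  have haux := mul_sum_log_affine_le hw hw1 hN N
  rw [hvN, Real.log_one, mul_zero, zero_sub] at haux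
  set S := ∑ k ∈ Finset.range N, Real.log (w + (1 - w) * ((k : ℝ) / N)) with hS
  have e2 : (N : ℝ) * (-1 + w * Real.log (1 / w) / (1 - w)) =
      N * (-1 - (w * Real.log w - w)) / (1 - w) := by
    rw [one_div, Real.log_inv]
    field_simp
    ring
  rw [e2, le_div_iff₀ h1w]
  have h3 := mul_le_mul_of_nonneg_left haux hN.le
  have e3 : (N : ℝ) * ((1 - w) / N * S) = S * (1 - w) := by
    field_simp
  linarith [h3, e3]

/-- **Entropy–Brégman log-sum estimate, square-root form.**  For `n ≥ 2` and `0 < w < 1`,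
`∑_{k<n} log (w + (1-w)·k/(n-1)) ≤ (n-1)·(2√w - 1)`: the sharp form `sum_log_affine_le_sharp`
combined with `w·log(1/w)/(1-w) ≤ 2√w` (`mul_log_one_div_le`). [folklore] -/
theorem sum_log_affine_le_two_sqrt (n : ℕ) (hn : 2 ≤ n) (w : ℝ) (hw : 0 < w) (hw1 : w < 1) :
    ∑ k ∈ Finset.range n, Real.log (w + (1 - w) * ((k : ℝ) / ((n : ℝ) - 1))) ≤
      ((n : ℝ) - 1) * (2 * Real.sqrt w - 1) := by
  refine (sum_log_affine_le_sharp n hn w hw hw1).trans ?_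
  have hN : (0 : ℝ) ≤ (n : ℝ) - 1 := by
    have : (2 : ℝ) ≤ n := by exact_mod_cast hn
    linarith
  apply mul_le_mul_of_nonneg_left _ hN
  have h1w : (0 : ℝ) < 1 - w := by linarith
  have hφ : w * Real.log (1 / w) / (1 - w) ≤ 2 * Real.sqrt w := by
    rw [div_le_iff₀ h1w]
    exact mul_log_one_div_le hw hw1.le
  linarith

/-- **Entropy–Brégman log-sum estimate** in the form used for the "minus one nat per vertex"
entropy bound with `η`-spread marginals (Cuckler–Kahn): for `n ≥ 2` and `0 < w < 1`,
`∑_{k<n} log (w + (1-w)·k/(n-1)) ≤ (n-1)·(4√w - 1)`.  Immediate from the `2√w` form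
`sum_log_affine_le_two_sqrt`. [folklore] -/
theorem sum_log_affine_le (n : ℕ) (hn : 2 ≤ n) (w : ℝ) (hw : 0 < w) (hw1 : w < 1) :
    ∑ k ∈ Finset.range n, Real.log (w + (1 - w) * ((k : ℝ) / ((n : ℝ) - 1))) ≤
      ((n : ℝ) - 1) * (4 * Real.sqrt w - 1) := by
  refine (sum_log_affine_le_two_sqrt n hn w hw hw1).trans ?_
  have hN : (0 : ℝ) ≤ (n : ℝ) - 1 := by
    have : (2 : ℝ) ≤ n := by exact_mod_cast hn
    linarith
  apply mul_le_mul_of_nonneg_left _ hN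
  linarith [Real.sqrt_nonneg w]

end Literature.Combinatorics.Enumerative
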